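import Mathlib
import HarnessLib

/-!
# Sampling a bounded unimodal profile on arithmetic progressions: variation, shifts and cell suprema (F_layer OneFcc, flux file (d))

HONEST FRAMING. Venture `Summits/Ventures/Crystal3D` (cell `crystal3d-full`); helper `--supports` the crux `CoaxialWallLaw`
(stmt-Ventures-19481, REGISTERED line `WallLedgerF`) in its role as owner of lane T's debt T-F2 / F_layer, OneFcc half; memo
HOME/wall-19481-p1/g16/TWO-FAMILY-LEDGER-g16.md §Ledger.  Pure elementary real analysis, standard axioms; nothing about the crux is claimed;
F-C1 not moved.

WHY.  The OneFcc ledger compares, plane by plane, per-plane line counts `∝ g(x_k)` with `g(x) = √((R²S² − x²)₊)` (half-chord × `S`)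
sampled on the arithmetic progression `x_k = x₀ + k d` of the layer planes' signed trace distances — at DIFFERENT cell heights (a height
change shifts every `x_k` by the same amount), for two parallel plane systems (a phase change), and against the CHARGE of the slabs between
consecutive planes (a supremum of `g` over the cell `[x_k − 1, x_{k+1} + 1]`).  All that is used about `g` is: `0 ≤ g ≤ M` and `g` is
antitone in `|x|`.  Then, with every bound UNIFORM in the sampling step `d > 0` (this is what makes the ledger uniform in the tilt):
* **`unimodal_variation_le`** — along any nondecreasing sequence `y`, `Σ_{n<N} |g(y_{n+1}) − g(y_n)| ≤ 3M` (induction on `N` with the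
  invariant `≤ g(y_N) − g(y_0)` while `y_N ≤ 0`, `≤ 3M − g(y_N)` after);
* `unimodal_frac_shift_le` (`0 ≤ f`, `y_n + f ≤ y_{n+1}`: `Σ |g(y_n + f) − g(y_n)| ≤ 3M`), `unimodal_nat_shift_le`
  (`Σ |g(y_{n+m}) − g(y_n)| ≤ 3mM`), **`unimodal_ap_shift_le`** (AP, any real shift `|D| ≤ Q d`: `Σ |g(x_n + D) − g(x_n)| ≤ 3(Q+1)M`);
* **`unimodal_cell_sup_le`** / **`unimodal_cell_sup_sum_le`** — with `1 ≤ 2d`, the cell supremum is dominated by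
  `g(p_k)`, `p_k = max (x_k − 1) (min 0 (x_{k+1} + 1))`, and `g(p_k) ≤ ½(g(x_k) + g(x_{k+1})) + e_k` with `e_k ≥ 0`, `Σ_{Icc} e_k ≤ 21M`.
WHAT THIS IS NOT: no geometry; F-C1 not moved.
-/

namespace Summit.Ventures.Crystal3D.Theorems

open Finset

section Unimodal

variable {g : ℝ → ℝ} {M : ℝ} (hanti : ∀ x y : ℝ, |x| ≤ |y| → g y ≤ g x) (hg0 : ∀ x, 0 ≤ g x) (hgM : ∀ x, g x ≤ M)

include hanti hg0 hgM

/-- **Variation of a bounded unimodal profile along a nondecreasing sequence is at most `3M`.** -/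
theorem unimodal_variation_le {y : ℕ → ℝ} (hy : ∀ n, y n ≤ y (n + 1)) (N : ℕ) :
    ∑ n ∈ Finset.range N, |g (y (n + 1)) - g (y n)| ≤ 3 * M := by
  have hM : 0 ≤ M := (hg0 0).trans (hgM 0)
  -- the invariant
  have key : ∀ N : ℕ, ∑ n ∈ Finset.range N, |g (y (n + 1)) - g (y n)| ≤
      (if y N ≤ 0 then g (y N) - g (y 0) else 3 * M - g (y N)) := by
    intro N
    induction N with
    | zero =>
      simp only [Finset.range_zero, Finset.sum_empty]
      split_ifs with h
      · simp
      · linarith [hgM (y 0)]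
    | succ N ih =>
      rw [Finset.sum_range_succ]
      by_cases h1 : y (N + 1) ≤ 0
      · have h0 : y N ≤ 0 := (hy N).trans h1
        rw [if_pos h0] at ih
        rw [if_pos h1]
        have hmono : g (y N) ≤ g (y (N + 1)) := hanti _ _ (by
          rw [abs_of_nonpos h1, abs_of_nonpos h0]; linarith [hy N])
        rw [abs_of_nonneg (by linarith)]
        linarith
      · rw [if_neg h1]
        push Not at h1
        by_cases h0 : y N ≤ 0
        · rw [if_pos h0] at ih
          have ht : |g (y (N + 1)) - g (y N)| ≤ M := by
            rw [abs_le]; constructor <;> linarith [hg0 (y N), hgM (y N), hg0 (y (N + 1)), hgM (y (N + 1))]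
          linarith [hgM (y N), hg0 (y 0), hgM (y (N + 1))]
        · rw [if_neg h0] at ih
          push Not at h0
          have hmono : g (y (N + 1)) ≤ g (y N) := hanti _ _ (by
            rw [abs_of_pos h0, abs_of_pos h1]; exact hy N)
          rw [abs_of_nonpos (by linarith)]
          linarith
  refine (key N).trans ?_
  split_ifs
  · linarith [hgM (y N), hg0 (y 0)]
  · linarith [hg0 (y N)]

/-- A fractional shift: `Σ |g(y_n + f) − g(y_n)| ≤ 3M` when `0 ≤ f` and `y_n + f ≤ y_{n+1}`. -/
theorem unimodal_frac_shift_le {y : ℕ → ℝ} {f : ℝ} (hf : 0 ≤ f) (hy : ∀ n, y n + f ≤ y (n + 1)) (N : ℕ) :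
    ∑ n ∈ Finset.range N, |g (y n + f) - g (y n)| ≤ 3 * M := by
  -- the merged sequence
  obtain ⟨w, hw⟩ : ∃ w : ℕ → ℝ, ∀ j, w j = if j % 2 = 0 then y (j / 2) else y (j / 2) + f := ⟨_, fun _ => rfl⟩
  have hw0 : ∀ n, w (2 * n) = y n := by
    intro n; rw [hw]; simp
  have hw1 : ∀ n, w (2 * n + 1) = y n + f := by
    intro n; rw [hw]
    have h1 : (2 * n + 1) % 2 = 1 := by omega
    have h2 : (2 * n + 1) / 2 = n := by omega
    simp [h1, h2]
  have hwmono : ∀ j, w j ≤ w (j + 1) := by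
    intro j
    obtain ⟨n, rfl | rfl⟩ := Nat.even_or_odd' j
    · rw [hw0, hw1]; linarith
    · rw [hw1, show 2 * n + 1 + 1 = 2 * (n + 1) by ring, hw0]; exact hy n
  have hvar := unimodal_variation_le hanti hg0 hgM hwmono (2 * N)
  -- the even-indexed part of the merged variation is the fractional-shift sum
  have hsplit : ∀ N : ℕ, ∑ j ∈ Finset.range (2 * N), |g (w (j + 1)) - g (w j)| =
      ∑ n ∈ Finset.range N, (|g (w (2 * n + 1)) - g (w (2 * n))| + |g (w (2 * n + 2)) - g (w (2 * n + 1))|) := by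
    intro N
    induction N with
    | zero => simp
    | succ N ih =>
      rw [show 2 * (N + 1) = 2 * N + 1 + 1 by ring, Finset.sum_range_succ, Finset.sum_range_succ, ih, Finset.sum_range_succ]
      ring_nf
  rw [hsplit] at hvar
  calc ∑ n ∈ Finset.range N, |g (y n + f) - g (y n)|
      = ∑ n ∈ Finset.range N, |g (w (2 * n + 1)) - g (w (2 * n))| := by
        refine Finset.sum_congr rfl fun n _ => ?_; rw [hw0, hw1]
    _ ≤ ∑ n ∈ Finset.range N, (|g (w (2 * n + 1)) - g (w (2 * n))| + |g (w (2 * n + 2)) - g (w (2 * n + 1))|) :=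
        Finset.sum_le_sum fun n _ => by linarith [abs_nonneg (g (w (2 * n + 2)) - g (w (2 * n + 1)))]
    _ ≤ 3 * M := hvar

/-- An integer shift: `Σ |g(y_{n+m}) − g(y_n)| ≤ 3mM` along a nondecreasing sequence. -/
theorem unimodal_nat_shift_le {y : ℕ → ℝ} (hy : ∀ n, y n ≤ y (n + 1)) (m N : ℕ) :
    ∑ n ∈ Finset.range N, |g (y (n + m)) - g (y n)| ≤ 3 * m * M := by
  induction m with
  | zero => simp
  | succ m ih =>
    have hstep : ∑ n ∈ Finset.range N, |g (y (n + 1 + m)) - g (y (n + m))| ≤ 3 * M :=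
      unimodal_variation_le hanti hg0 hgM (y := fun n => y (n + m)) (fun n => by
        show y (n + m) ≤ y (n + 1 + m)
        rw [Nat.add_right_comm]; exact hy (n + m)) N
    calc ∑ n ∈ Finset.range N, |g (y (n + (m + 1))) - g (y n)|
        ≤ ∑ n ∈ Finset.range N, (|g (y (n + 1 + m)) - g (y (n + m))| + |g (y (n + m)) - g (y n)|) := by
          refine Finset.sum_le_sum fun n _ => ?_
          rw [show n + (m + 1) = n + 1 + m by omega]
          exact abs_sub_le _ _ _
      _ ≤ 3 * M + 3 * m * M := by rw [Finset.sum_add_distrib]; linarith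
      _ = 3 * ((m + 1 : ℕ) : ℝ) * M := by push_cast; ring

/-- **A real shift of an arithmetic progression**: `|D| ≤ Q d` ⇒ `Σ_{n<N} |g(x₀ + n d + D) − g(x₀ + n d)| ≤ 3(Q+1)M`. -/
theorem unimodal_ap_shift_le {d : ℝ} (hd : 0 < d) (x₀ D : ℝ) (Q : ℕ) (hD : |D| ≤ Q * d) (N : ℕ) :
    ∑ n ∈ Finset.range N, |g (x₀ + n * d + D) - g (x₀ + n * d)| ≤ 3 * (Q + 1) * M := by
  have hM : 0 ≤ M := (hg0 0).trans (hgM 0)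
  -- the nonnegative case, for every base point
  have pos : ∀ (x₁ D' : ℝ), 0 ≤ D' → D' ≤ Q * d →
      ∑ n ∈ Finset.range N, |g (x₁ + n * d + D') - g (x₁ + n * d)| ≤ 3 * (Q + 1) * M := by
    intro x₁ D' hD'0 hD'Q
    set q : ℕ := ⌊D' / d⌋.toNat with hq
    have hqz : (q : ℤ) = ⌊D' / d⌋ := by rw [hq]; exact Int.toNat_of_nonneg (Int.floor_nonneg.2 (div_nonneg hD'0 hd.le))
    have hqle : (q : ℝ) ≤ D' / d := by
      have : ((q : ℤ) : ℝ) ≤ D' / d := by rw [hqz]; exact Int.floor_le _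
      exact_mod_cast this
    have hqlt : D' / d < (q : ℝ) + 1 := by
      have : D' / d < ((q : ℤ) : ℝ) + 1 := by rw [hqz]; exact Int.lt_floor_add_one _
      exact_mod_cast this
    set f : ℝ := D' - q * d with hf
    have hf0 : 0 ≤ f := by rw [hf]; have := mul_le_mul_of_nonneg_right hqle hd.le; rw [div_mul_cancel₀ _ hd.ne'] at this; linarith
    have hfd : f ≤ d := by
      rw [hf]; have := mul_le_mul_of_nonneg_right hqlt.le hd.le; rw [div_mul_cancel₀ _ hd.ne'] at this; linarith
    have hqQ : (q : ℝ) ≤ Q := by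
      have h1 : (q : ℝ) * d ≤ D' := by
        have := mul_le_mul_of_nonneg_right hqle hd.le; rwa [div_mul_cancel₀ _ hd.ne'] at this
      by_contra hh; push Not at hh
      have : (Q : ℝ) + 1 ≤ q := by exact_mod_cast (show Q + 1 ≤ q by exact_mod_cast hh)
      nlinarith
    set y : ℕ → ℝ := fun n => x₁ + n * d with hy
    have hymono : ∀ n, y n ≤ y (n + 1) := fun n => by simp only [hy]; push_cast; nlinarith
    have e : ∀ n : ℕ, x₁ + n * d + D' = y (n + q) + f := by intro n; simp only [hy, hf]; push_cast; ring
    have h1 : ∑ n ∈ Finset.range N, |g (y (n + q) + f) - g (y (n + q))| ≤ 3 * M :=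
      unimodal_frac_shift_le hanti hg0 hgM (y := fun n => y (n + q)) hf0 (fun n => by
        simp only [hy]; push_cast; nlinarith) N
    have h2 := unimodal_nat_shift_le hanti hg0 hgM hymono q N
    calc ∑ n ∈ Finset.range N, |g (x₁ + n * d + D') - g (x₁ + n * d)|
        = ∑ n ∈ Finset.range N, |g (y (n + q) + f) - g (y n)| := Finset.sum_congr rfl fun n _ => by rw [e]
      _ ≤ ∑ n ∈ Finset.range N, (|g (y (n + q) + f) - g (y (n + q))| + |g (y (n + q)) - g (y n)|) :=
          Finset.sum_le_sum fun n _ => abs_sub_le _ _ _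
      _ ≤ 3 * M + 3 * q * M := by rw [Finset.sum_add_distrib]; linarith
      _ ≤ 3 * (Q + 1) * M := by nlinarith
  by_cases hD0 : 0 ≤ D
  · exact pos x₀ D hD0 (by rw [abs_of_nonneg hD0] at hD; exact hD)
  · push Not at hD0
    -- shift the base point: `x₀ + n d = (x₀ + D) + n d + (−D)`
    have h := pos (x₀ + D) (-D) (by linarith) (by rw [abs_of_neg hD0] at hD; exact hD)
    calc ∑ n ∈ Finset.range N, |g (x₀ + n * d + D) - g (x₀ + n * d)|
        = ∑ n ∈ Finset.range N, |g (x₀ + D + n * d + -D) - g (x₀ + D + n * d)| := by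
          refine Finset.sum_congr rfl fun n _ => ?_
          rw [abs_sub_comm]; congr 2 <;> ring_nf
      _ ≤ 3 * (Q + 1) * M := h

omit hg0 hgM in
/-- **The cell supremum**: on `[x_k − 1, x_{k+1} + 1]` the profile is dominated by its value at the point of the interval nearest `0`. -/
theorem unimodal_cell_sup_le (a b y : ℝ) (hab : a ≤ b) (hy : a ≤ y ∧ y ≤ b) : g y ≤ g (max a (min 0 b)) := by
  refine hanti _ _ ?_
  -- `|max a (min 0 b)| ≤ |y|`
  rcases le_or_gt 0 a with ha | ha
  · have hb : 0 ≤ b := ha.trans hab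
    rw [min_eq_left hb, max_eq_left ha, abs_of_nonneg ha, abs_of_nonneg (ha.trans hy.1)]; exact hy.1
  · rcases le_or_gt 0 b with hb | hb
    · rw [min_eq_left hb, max_eq_right ha.le, abs_zero]; exact abs_nonneg _
    · rw [min_eq_right hb.le, max_eq_right (hab.trans (le_refl b)), abs_of_neg hb, abs_of_nonpos (hy.2.trans hb.le)]
      linarith [hy.2]

/-- **Summing the cell suprema against the two bounding planes.**  For the AP `x_k = x₀ + k d` with `1 ≤ 2d`, the point
`p_k = max (x_k − 1) (min 0 (x_{k+1} + 1))` satisfies `g(p_k) ≤ ½(g(x_k) + g(x_{k+1})) + e_k`, `e_k ≥ 0`, `Σ_{k=A}^{A+N} e_k ≤ 21M`. -/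
theorem unimodal_cell_sup_sum_le {d : ℝ} (hd : 0 < d) (hd2 : 1 ≤ 2 * d) (x₀ : ℝ) :
    ∃ e : ℤ → ℝ, (∀ k, 0 ≤ e k) ∧
      (∀ k : ℤ, g (max (x₀ + k * d - 1) (min 0 (x₀ + (k + 1) * d + 1))) ≤
        (g (x₀ + k * d) + g (x₀ + (k + 1) * d)) / 2 + e k) ∧
      (∀ (A : ℤ) (N : ℕ), ∑ n ∈ Finset.range N, e (A + n) ≤ 21 * M) := by
  have hM : 0 ≤ M := (hg0 0).trans (hgM 0)
  set x : ℤ → ℝ := fun k => x₀ + k * d with hx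
  -- exceptional cells: the mode within two steps
  set exc : ℤ → ℝ := fun k => if x (k - 2) ≤ 0 ∧ 0 ≤ x (k + 3) then M else 0 with hexc
  set v₁ : ℤ → ℝ := fun k => |g (x (k - 2)) - g (x k)| with hv₁
  set v₂ : ℤ → ℝ := fun k => |g (x (k - 2)) - g (x (k + 1))| with hv₂
  set v₃ : ℤ → ℝ := fun k => |g (x (k + 3)) - g (x k)| with hv₃
  set v₄ : ℤ → ℝ := fun k => |g (x (k + 3)) - g (x (k + 1))| with hv₄
  have hv0 : ∀ k, 0 ≤ v₁ k ∧ 0 ≤ v₂ k ∧ 0 ≤ v₃ k ∧ 0 ≤ v₄ k := fun k =>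
    ⟨abs_nonneg _, abs_nonneg _, abs_nonneg _, abs_nonneg _⟩
  set e : ℤ → ℝ := fun k => (v₁ k + v₂ k + v₃ k + v₄ k) / 2 + exc k with he
  have hexc0 : ∀ k, 0 ≤ exc k := fun k => by simp only [hexc]; split_ifs <;> linarith
  have tri : ∀ a b c : ℝ, a ≤ (b + c) / 2 + (|a - b| + |a - c|) / 2 := by
    intro a b c
    have h1 := le_abs_self (a - b); have h2 := le_abs_self (a - c); linarith
  have aux : ∀ k : ℤ, g (max (x k - 1) (min 0 (x (k + 1) + 1))) ≤ (g (x k) + g (x (k + 1))) / 2 + e k := by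
    intro k
    have hxk2 : x (k - 2) ≤ x k - 1 := by simp only [hx]; push_cast; nlinarith
    have hxk3 : x (k + 1) + 1 ≤ x (k + 3) := by simp only [hx]; push_cast; nlinarith
    set p := max (x k - 1) (min 0 (x (k + 1) + 1)) with hp
    obtain ⟨h01, h02, h03, h04⟩ := hv0 k
    by_cases hcase : x (k - 2) ≤ 0 ∧ 0 ≤ x (k + 3)
    · have hexck : exc k = M := by simp only [hexc]; rw [if_pos hcase]
      have hek : M ≤ e k := by simp only [he]; rw [hexck]; linarith
      linarith [hgM p, hg0 (x k), hg0 (x (k + 1))]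
    · have hexck : exc k = 0 := by simp only [hexc]; rw [if_neg hcase]
      rw [not_and_or] at hcase
      rcases hcase with hr | hl
      · -- right of the mode: `0 < x (k−2) ≤ p`, so `g p ≤ g (x (k−2))`
        push Not at hr
        have hp0 : x (k - 2) ≤ p := by rw [hp]; exact le_trans hxk2 (le_max_left _ _)
        have hgp : g p ≤ g (x (k - 2)) := hanti _ _ (by
          rw [abs_of_pos hr, abs_of_pos (lt_of_lt_of_le hr hp0)]; exact hp0)
        have ht := tri (g (x (k - 2))) (g (x k)) (g (x (k + 1)))
        have he' : e k = (v₁ k + v₂ k + v₃ k + v₄ k) / 2 + exc k := rfl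
        rw [he', hexck]
        have e1 : v₁ k = |g (x (k - 2)) - g (x k)| := rfl
        have e2 : v₂ k = |g (x (k - 2)) - g (x (k + 1))| := rfl
        linarith
      · -- left of the mode
        push Not at hl
        have hxk1 : x k ≤ x (k + 1) := by simp only [hx]; push_cast; nlinarith
        have hp0 : p ≤ x (k + 3) := by
          rw [hp]
          refine max_le (by linarith [hxk1, hxk3]) ?_
          exact le_trans (min_le_right _ _) hxk3
        have hgp : g p ≤ g (x (k + 3)) := hanti _ _ (by
          rw [abs_of_neg hl, abs_of_neg (lt_of_le_of_lt hp0 hl)]; linarith)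
        have ht := tri (g (x (k + 3))) (g (x k)) (g (x (k + 1)))
        have he' : e k = (v₁ k + v₂ k + v₃ k + v₄ k) / 2 + exc k := rfl
        rw [he', hexck]
        have e3 : v₃ k = |g (x (k + 3)) - g (x k)| := rfl
        have e4 : v₄ k = |g (x (k + 3)) - g (x (k + 1))| := rfl
        linarith
  refine ⟨e, fun k => by obtain ⟨h01, h02, h03, h04⟩ := hv0 k; simp only [he]; linarith [hexc0 k], fun k => ?_, fun A N => ?_⟩
  · have h := aux k
    have e1 : x k = x₀ + k * d := rfl
    have e2 : x (k + 1) = x₀ + (k + 1) * d := by simp only [hx]; push_cast; ring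
    rw [e1, e2] at h
    exact h
  · -- the sum of the errors over a window
    have hyA : ∀ (c : ℤ), ∀ n : ℕ, x (A + n + c) = (x₀ + (A + c) * d) + n * d := by
      intro c n; simp only [hx]; push_cast; ring
    -- the four shift sums
    have s1 : ∑ n ∈ Finset.range N, |g (x (A + n - 2)) - g (x (A + n))| ≤ 3 * 2 * M := by
      have h := unimodal_nat_shift_le hanti hg0 hgM (y := fun n : ℕ => (x₀ + (A - 2) * d) + n * d)
        (fun n => by push_cast; nlinarith) 2 N
      refine le_trans (le_of_eq (Finset.sum_congr rfl fun n _ => ?_)) h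
      rw [abs_sub_comm]; congr 2 <;> simp only [hx] <;> push_cast <;> ring
    have s2 : ∑ n ∈ Finset.range N, |g (x (A + n - 2)) - g (x (A + n + 1))| ≤ 3 * 3 * M := by
      have h := unimodal_nat_shift_le hanti hg0 hgM (y := fun n : ℕ => (x₀ + (A - 2) * d) + n * d)
        (fun n => by push_cast; nlinarith) 3 N
      refine le_trans (le_of_eq (Finset.sum_congr rfl fun n _ => ?_)) h
      rw [abs_sub_comm]; congr 2 <;> simp only [hx] <;> push_cast <;> ring
    have s3 : ∑ n ∈ Finset.range N, |g (x (A + n + 3)) - g (x (A + n))| ≤ 3 * 3 * M := by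
      have h := unimodal_nat_shift_le hanti hg0 hgM (y := fun n : ℕ => (x₀ + A * d) + n * d)
        (fun n => by push_cast; nlinarith) 3 N
      refine le_trans (le_of_eq (Finset.sum_congr rfl fun n _ => ?_)) h
      congr 2 <;> simp only [hx] <;> push_cast <;> ring
    have s4 : ∑ n ∈ Finset.range N, |g (x (A + n + 3)) - g (x (A + n + 1))| ≤ 3 * 2 * M := by
      have h := unimodal_nat_shift_le hanti hg0 hgM (y := fun n : ℕ => (x₀ + (A + 1) * d) + n * d)
        (fun n => by push_cast; nlinarith) 2 N
      refine le_trans (le_of_eq (Finset.sum_congr rfl fun n _ => ?_)) h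
      congr 2 <;> simp only [hx] <;> push_cast <;> ring
    -- at most six exceptional cells
    have s5 : ∑ n ∈ Finset.range N, exc (A + n) ≤ 6 * M := by
      -- the exceptional `k` satisfy `x (k−2) ≤ 0 ≤ x (k+3)`, i.e. `k ∈ [u − 3, u + 2]` for `u = −x₀/d`
      set Ex := (Finset.range N).filter fun n : ℕ => x (A + (n : ℤ) - 2) ≤ 0 ∧ 0 ≤ x (A + (n : ℤ) + 3) with hEx
      have hsum : ∑ n ∈ Finset.range N, exc (A + n) = M * (Ex.card : ℝ) := by
        rw [Finset.card_eq_sum_ones, Nat.cast_sum, Finset.mul_sum, Finset.sum_filter]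
        refine Finset.sum_congr rfl fun n _ => ?_
        simp only [hexc, Nat.cast_one, mul_one]
      have hcard : (Ex.card : ℝ) ≤ 6 := by
        have hmem : ∀ n ∈ Ex, -x₀ / d - 3 ≤ ((A + (n : ℤ) : ℤ) : ℝ) ∧ ((A + (n : ℤ) : ℤ) : ℝ) ≤ -x₀ / d + 2 := by
          intro n hn
          obtain ⟨-, h1, h2⟩ := Finset.mem_filter.1 hn
          simp only [hx] at h1 h2
          push_cast at h1 h2 ⊢
          constructor
          · rw [div_sub' (hc := hd.ne'), div_le_iff₀ hd]; nlinarith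
          · rw [div_add' (hc := hd.ne'), le_div_iff₀ hd]; nlinarith
        -- inject `Ex` into the integers of an interval of length `5`
        have hinj : Ex.card = (Ex.image fun n : ℕ => (A + (n : ℤ) : ℤ)).card := by
          rw [Finset.card_image_of_injective]
          intro a b hab
          have : (A + (a : ℤ) : ℤ) = A + (b : ℤ) := hab
          exact_mod_cast (add_left_cancel this)
        have hsub : Ex.image (fun n : ℕ => (A + (n : ℤ) : ℤ)) ⊆ Finset.Icc ⌈-x₀ / d - 3⌉ ⌊-x₀ / d + 2⌋ := by
          intro k hk
          obtain ⟨n, hn, rfl⟩ := Finset.mem_image.1 hk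
          obtain ⟨h1, h2⟩ := hmem n hn
          exact Finset.mem_Icc.2 ⟨Int.ceil_le.2 h1, Int.le_floor.2 h2⟩
        have h3 := Finset.card_le_card hsub
        have h4 : ((Finset.Icc ⌈-x₀ / d - 3⌉ ⌊-x₀ / d + 2⌋).card : ℝ) ≤ 6 := by
          have hc : ((Finset.Icc ⌈-x₀ / d - 3⌉ ⌊-x₀ / d + 2⌋).card : ℤ) = max 0 (⌊-x₀ / d + 2⌋ + 1 - ⌈-x₀ / d - 3⌉) := by
            rw [Int.card_Icc, Int.toNat_eq_max]; simp [max_comm]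
          have h5 : (⌊-x₀ / d + 2⌋ : ℝ) ≤ -x₀ / d + 2 := Int.floor_le _
          have h6 : -x₀ / d - 3 ≤ (⌈-x₀ / d - 3⌉ : ℝ) := Int.le_ceil _
          have h7 : ((⌊-x₀ / d + 2⌋ + 1 - ⌈-x₀ / d - 3⌉ : ℤ) : ℝ) ≤ 6 := by push_cast; linarith
          have h8 : ((max 0 (⌊-x₀ / d + 2⌋ + 1 - ⌈-x₀ / d - 3⌉) : ℤ) : ℝ) ≤ 6 := by
            rw [Int.cast_max]; exact max_le (by norm_num) h7
          have : (((Finset.Icc ⌈-x₀ / d - 3⌉ ⌊-x₀ / d + 2⌋).card : ℤ) : ℝ) ≤ 6 := by rw [hc]; exact h8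
          exact_mod_cast this
        calc (Ex.card : ℝ) = ((Ex.image fun n : ℕ => (A + (n : ℤ) : ℤ)).card : ℝ) := by rw [hinj]
          _ ≤ ((Finset.Icc ⌈-x₀ / d - 3⌉ ⌊-x₀ / d + 2⌋).card : ℝ) := by exact_mod_cast h3
          _ ≤ 6 := h4
      rw [hsum]; nlinarith
    -- assemble
    have hterm : ∀ n : ℕ, e (A + n) = (v₁ (A + n) + v₂ (A + n) + v₃ (A + n) + v₄ (A + n)) / 2 + exc (A + n) :=
      fun n => rfl
    have : ∑ n ∈ Finset.range N, e (A + n) = (∑ n ∈ Finset.range N, v₁ (A + n) +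
        ∑ n ∈ Finset.range N, v₂ (A + n) + ∑ n ∈ Finset.range N, v₃ (A + n) +
        ∑ n ∈ Finset.range N, v₄ (A + n)) / 2 + ∑ n ∈ Finset.range N, exc (A + n) := by
      rw [Finset.sum_congr rfl fun n _ => hterm n, Finset.sum_add_distrib, ← Finset.sum_div, Finset.sum_add_distrib,
        Finset.sum_add_distrib, Finset.sum_add_distrib]
    rw [this]
    have e1 : ∀ n : ℕ, v₁ (A + n) = |g (x (A + n - 2)) - g (x (A + n))| := fun n => rfl
    have e2 : ∀ n : ℕ, v₂ (A + n) = |g (x (A + n - 2)) - g (x (A + n + 1))| := fun n => rfl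
    have e3 : ∀ n : ℕ, v₃ (A + n) = |g (x (A + n + 3)) - g (x (A + n))| := fun n => rfl
    have e4 : ∀ n : ℕ, v₄ (A + n) = |g (x (A + n + 3)) - g (x (A + n + 1))| := fun n => rfl
    simp only [e1, e2, e3, e4]
    linarith

end Unimodal

end Summit.Ventures.Crystal3D.Theorems
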